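import Summits.PneNP.PneNP.Theorems.ChebyshevTracialDesignExtendedSignSharp
import HarnessLib

/-!
# Cell pnp-psdrank, route `ChebyshevTracialDesign`: LOW-DEGREE AND SOS MASKS ARE FREE — multiplying a Gram cut factor of Johnson degree `k` by a
# scalar mask of Johnson degree `j` ({0,1}-valued, or a sum of squares of degree-`j` functions) gives a Gram field of degree `j + k`, priced by the
# SIGN cell as long as `j + k ≤ c'` (crux `TracialDecayExp20`, stmt-PneNP-19878)

Brick 96 (prover g18; MEMO-21 §3). The fourth barrier (`Literature.Barriers.PneNP.GramMinorantLayerEnergy`) shows that an AMPLITUDE `f ≥ 0` of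
HIGH degree in front of a low-degree sign feature destroys every low-degree psd Gram minorant; brick 95 (`…HighPassInvisible`) prices the case
where the amplitude's oscillation is purely of degree `> D`. This file records the complementary, elementary end of the amplitude taxonomy:
* §1 the algebra of `IsLowDegreeU` (Literature `TracialDesignsLowDegree`): `lowSpan n k` = the span of the containment indicators `1[A ⊆ U]`,
  `|A| ≤ k`; **`mul_mem_lowSpan`** (`V_j · V_k ⊆ V_{j+k}`: `1[A⊆U]·1[A'⊆U] = 1[A∪A'⊆U]`), `lowSpan_mono`, **`IsLowDegreeU.mono`** (monotone in
  the degree — the remark used by bricks 94b/95: `D ≤ k` is no restriction), **`IsLowDegreeU.smul`** (a degree-`j` scalar times a degree-`k`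
  factor has degree `j + k`), **`isLowDegreeU_sosStack`** (the stacked factor `[g_1 A | … | g_L A]` of an SOS mask `Σ_l g_l²` has degree `j + k`)
  with `sosStack_mul_transpose` (`[g_1A|…|g_LA][g_1A|…|g_LA]ᵀ = (Σ_l g_l²)·A Aᵀ`; the stacked factor is written out as a `Matrix.of`, no definition).
* §2 **`value_le_of_sosMask`** — for `n` even, an exact design `(n, t = 2c'+1, T, D ≤ 2c', B_v, C, w)`, a cut factor `A` of Johnson degree
  `≤ k`, scalar functions `g_1,…,g_L` of Johnson degree `≤ j` with `D ≤ j + k ≤ c'` and `(Σ_l g_l(U)²)·A_U A_Uᵀ ⪯ I`, and any psd-contraction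
  matching side `Y`: `Σ W·(Σ_l g_l²)·tr(A_U A_Uᵀ Y_M) ≤ r·(B_v√P_D + 2^{j+k+1}√P_{j+k} + Σ_{κ∈(D/2,(j+k)/2]} R_κ√A_κ)` (brick 94b at degree
  `j + k`); **`value_le_of_boolMask`** — the same for a {0,1}-VALUED mask `f` of Johnson degree `≤ j` (`f = f²`), e.g. junta masks
  `1[U ⊇ J]` (`j = |J|`) or `1[U ∩ J = ∅]`, WITHOUT any pinned-cell recursion.
So in the amplitude class `f · A Aᵀ` (MEMO-21 §3) the mask costs nothing while `deg f + k ≤ c' ≍ n/8`: juntas, low-degree polynomials that are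
sums of squares, and — up to the operator-norm slack of brick 88 §5 — every mask uniformly `e^{-aD}`-close to such an SOS (thresholds of linear
statistics: approximate degree `O(√(t·aD)) = O(n^{5/8})`, MEMO-20 §2(d)); what remains of the class is masks of high APPROXIMATE degree whose
low harmonics are not those of a bounded SOS (MEMO-21 §3 (BSM)/(CG_k)).
[cite: Grigoriev2001, Lemma 1.4 (PDF p. 8)] [cite: Rothvoss2017, §2 (PDF p. 6)] [cite: LeeRaghavendraSteurer2015, §5]
[cite: GriblingDelaatLaurent2019, §5]
Stature: support/instrument (kernel lane, no defs; axioms standard). WHAT THIS IS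
NOT: nothing on masks of high approximate degree, no proof or refutation of `TracialDecayExp20`, nothing on psd rank of P_PM(K_n), no
P-vs-NP content. Supports stmt-PneNP-19878.
-/

set_option linter.dupNamespace false -- `Summit.PneNP.PneNP.…`: summit = sub-problem (D-0017)

noncomputable section

namespace Summit.PneNP.PneNP.Theorems.ChebyshevTracialDesignLowDegreeMasks

open Finset Matrix Literature.Barriers.PneNP Literature.Combinatorics.Optimization
open Summit.PneNP.PneNP.Theorems.ChebyshevTracialDesignExtendedSignSharp (value_le_of_lowDegree_allModes_sharp)
open scoped MatrixOrder

variable {n : ℕ}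

/-! ### §1 The algebra of low Johnson degree -/

/-- The containment indicator `U ↦ 1[A ⊆ U]` on the odd cuts. [cite: LeeRaghavendraSteurer2015, §5] -/
theorem indicator_mul_indicator (A A' : Finset (Fin n)) (U : OddSet n) :
    (if A ⊆ U.1 then (1 : ℝ) else 0) * (if A' ⊆ U.1 then (1 : ℝ) else 0) = if A ∪ A' ⊆ U.1 then (1 : ℝ) else 0 := by
  by_cases hA : A ⊆ U.1 <;> by_cases hA' : A' ⊆ U.1 <;> simp [hA, hA', Finset.union_subset_iff]

/-- `V_j · V_k ⊆ V_{j+k}`: the product of a combination of containment indicators of sets of size `≤ j` with one of sets of size `≤ k` is a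
combination of containment indicators of sets of size `≤ j + k`. [cite: LeeRaghavendraSteurer2015, §5] -/
theorem mul_mem_lowSpan {j k : ℕ} {g h : OddSet n → ℝ}
    (hg : g ∈ Submodule.span ℝ (Set.range fun A' : {A' : Finset (Fin n) // A'.card ≤ j} =>
      fun U : OddSet n => if A'.1 ⊆ U.1 then (1 : ℝ) else 0))
    (hh : h ∈ Submodule.span ℝ (Set.range fun A' : {A' : Finset (Fin n) // A'.card ≤ k} =>
      fun U : OddSet n => if A'.1 ⊆ U.1 then (1 : ℝ) else 0)) :
    (fun U => g U * h U) ∈ Submodule.span ℝ (Set.range fun A' : {A' : Finset (Fin n) // A'.card ≤ j + k} =>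
      fun U : OddSet n => if A'.1 ⊆ U.1 then (1 : ℝ) else 0) := by
  classical
  obtain ⟨α, hα⟩ := (Submodule.mem_span_range_iff_exists_fun ℝ).1 hg
  obtain ⟨β, hβ⟩ := (Submodule.mem_span_range_iff_exists_fun ℝ).1 hh
  have e : (fun U => g U * h U) = ∑ a : {A' : Finset (Fin n) // A'.card ≤ j}, ∑ b : {A' : Finset (Fin n) // A'.card ≤ k},
      (α a * β b) • (fun U : OddSet n => if a.1 ∪ b.1 ⊆ U.1 then (1 : ℝ) else 0) := by
    funext U
    rw [← hα, ← hβ]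
    simp only [Finset.sum_apply, Pi.smul_apply, smul_eq_mul]
    rw [Finset.sum_mul_sum]
    refine sum_congr rfl fun a _ => sum_congr rfl fun b _ => ?_
    rw [← indicator_mul_indicator]; ring
  rw [e]
  refine Submodule.sum_mem _ fun a _ => Submodule.sum_mem _ fun b _ => Submodule.smul_mem _ _ (Submodule.subset_span ?_)
  exact ⟨⟨a.1 ∪ b.1, (card_union_le _ _).trans (Nat.add_le_add a.2 b.2)⟩, rfl⟩

/-- `V_k ⊆ V_{k'}` for `k ≤ k'`. [cite: LeeRaghavendraSteurer2015, §5] -/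
theorem lowSpan_mono {k k' : ℕ} (hkk : k ≤ k') :
    Submodule.span ℝ (Set.range fun A' : {A' : Finset (Fin n) // A'.card ≤ k} =>
      fun U : OddSet n => if A'.1 ⊆ U.1 then (1 : ℝ) else 0) ≤
    Submodule.span ℝ (Set.range fun A' : {A' : Finset (Fin n) // A'.card ≤ k'} =>
      fun U : OddSet n => if A'.1 ⊆ U.1 then (1 : ℝ) else 0) := by
  refine Submodule.span_mono ?_
  rintro _ ⟨A', rfl⟩
  exact ⟨⟨A'.1, A'.2.trans hkk⟩, rfl⟩

/-- **`IsLowDegreeU` is monotone in the degree.** [cite: LeeRaghavendraSteurer2015, §5] -/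
theorem IsLowDegreeU.mono {k k' r m : ℕ} {A : OddSet n → Matrix (Fin r) (Fin m) ℝ} (hA : IsLowDegreeU n k A) (hkk : k ≤ k') :
    IsLowDegreeU n k' A := fun i c => lowSpan_mono hkk (hA i c)

/-- **A degree-`j` scalar times a degree-`k` factor has degree `j + k`.** [cite: LeeRaghavendraSteurer2015, §5] -/
theorem IsLowDegreeU.smul {j k r m : ℕ} {g : OddSet n → ℝ}
    (hg : g ∈ Submodule.span ℝ (Set.range fun A' : {A' : Finset (Fin n) // A'.card ≤ j} =>
      fun U : OddSet n => if A'.1 ⊆ U.1 then (1 : ℝ) else 0))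
    {A : OddSet n → Matrix (Fin r) (Fin m) ℝ} (hA : IsLowDegreeU n k A) :
    IsLowDegreeU n (j + k) (fun U => g U • A U) := by
  intro i c
  have := mul_mem_lowSpan hg (hA i c)
  simpa only [Matrix.smul_apply, smul_eq_mul] using this

/-- **`[g_1A|…|g_LA]·[g_1A|…|g_LA]ᵀ = (Σ_l g_l²)·A Aᵀ`** for the STACKED factor `[g_1 A | … | g_L A]` (columns indexed by `Fin (L·m)`
through `finProdFinEquiv`). [folklore] -/
theorem sosStack_mul_transpose {r m L : ℕ} (g : Fin L → OddSet n → ℝ) (A : OddSet n → Matrix (Fin r) (Fin m) ℝ) (U : OddSet n) :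
    (Matrix.of fun (i : Fin r) (lc : Fin (L * m)) => g (finProdFinEquiv.symm lc).1 U * A U i (finProdFinEquiv.symm lc).2) *
        (Matrix.of fun (i : Fin r) (lc : Fin (L * m)) => g (finProdFinEquiv.symm lc).1 U * A U i (finProdFinEquiv.symm lc).2)ᵀ =
      (∑ l, g l U ^ 2) • (A U * (A U)ᵀ) := by
  ext a b
  rw [Matrix.mul_apply, Matrix.smul_apply, Matrix.mul_apply, smul_eq_mul, Finset.sum_mul]
  rw [← finProdFinEquiv.sum_comp, Fintype.sum_prod_type]
  refine sum_congr rfl fun l _ => ?_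
  rw [Finset.mul_sum]
  refine sum_congr rfl fun c _ => ?_
  simp only [Matrix.of_apply, Matrix.transpose_apply, Equiv.symm_apply_apply]
  ring

/-- **The stacked factor of an SOS mask of degree `j` over a degree-`k` factor has degree `j + k`.** [cite: LeeRaghavendraSteurer2015, §5] -/
theorem isLowDegreeU_sosStack {j k r m L : ℕ} {g : Fin L → OddSet n → ℝ}
    (hg : ∀ l, g l ∈ Submodule.span ℝ (Set.range fun A' : {A' : Finset (Fin n) // A'.card ≤ j} =>
      fun U : OddSet n => if A'.1 ⊆ U.1 then (1 : ℝ) else 0))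
    {A : OddSet n → Matrix (Fin r) (Fin m) ℝ} (hA : IsLowDegreeU n k A) :
    IsLowDegreeU n (j + k) (fun U => (Matrix.of fun (i : Fin r) (lc : Fin (L * m)) =>
      g (finProdFinEquiv.symm lc).1 U * A U i (finProdFinEquiv.symm lc).2)) := by
  intro i lc
  have e : (fun U => (Matrix.of fun (i : Fin r) (lc : Fin (L * m)) =>
      g (finProdFinEquiv.symm lc).1 U * A U i (finProdFinEquiv.symm lc).2) i lc) =
      fun U => g (finProdFinEquiv.symm lc).1 U * A U i (finProdFinEquiv.symm lc).2 := by
    funext U; rfl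
  rw [e]
  exact mul_mem_lowSpan (hg (finProdFinEquiv.symm lc).1) (hA i (finProdFinEquiv.symm lc).2)

/-! ### §2 SOS masks and {0,1} masks of low degree are priced by the SIGN cell -/

/-- **SOS MASKS ARE FREE.** For `n` even, an exact design `(n, t = 2c'+1, T, D ≤ 2c', B_v, C, w)`, a cut factor `A` of Johnson degree `≤ k`,
scalars `g_1,…,g_L` of Johnson degree `≤ j` with `D ≤ j + k ≤ c'` and `(Σ_l g_l²)·A Aᵀ ⪯ I`, and any psd-contraction matching side `Y`:
`Σ_{U,M} W(U,M)·(Σ_l g_l(U)²)·tr(A_U A_Uᵀ Y_M) ≤ r·(B_v√P_D + 2^{j+k+1}√P_{j+k} + Σ_{κ∈(D/2,(j+k)/2]} R_κ√A_κ)`.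
[cite: Grigoriev2001, Lemma 1.4 (PDF p. 8)] [cite: Rothvoss2017, §2 (PDF p. 6)] [cite: GriblingDelaatLaurent2019, §5] -/
theorem value_le_of_sosMask {c' T D : ℕ} {Bv : ℝ} {C : Finset ℕ} {w : ℕ → ℝ} (hn : Even n)
    (hdes : IsExactDesign n (2 * c' + 1) T D Bv C w) (hD : D ≤ 2 * c') {r m k j L : ℕ} (hDk : D ≤ j + k) (hkc : j + k ≤ c')
    (A : OddSet n → Matrix (Fin r) (Fin m) ℝ) (hA : IsLowDegreeU n k A) (g : Fin L → OddSet n → ℝ)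
    (hg : ∀ l, g l ∈ Submodule.span ℝ (Set.range fun A' : {A' : Finset (Fin n) // A'.card ≤ j} =>
      fun U : OddSet n => if A'.1 ⊆ U.1 then (1 : ℝ) else 0))
    (h1 : ∀ U, (1 - (∑ l, g l U ^ 2) • (A U * (A U)ᵀ)).PosSemidef)
    (Y : PMatch n → Matrix (Fin r) (Fin r) ℝ) (hY : ∀ M, (Y M).PosSemidef ∧ (1 - Y M).PosSemidef) :
    ∑ U, ∑ M, levelWeight n (2 * c' + 1) C w U M * (((∑ l, g l U ^ 2) • (A U * (A U)ᵀ)) * Y M).trace ≤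
      (r : ℝ) * (Bv * Real.sqrt (∏ i ∈ range (D / 2 + 1), ((2 * i + 1 : ℝ) / ((n : ℝ) - 2 * i))) +
        2 ^ (j + k + 1) * Real.sqrt (∏ i ∈ range ((j + k) / 2 + 1), ((2 * i + 1 : ℝ) / ((n : ℝ) - 2 * i))) +
        ∑ κ ∈ Ico (D / 2 + 1) ((j + k) / 2 + 1),
          (∏ i ∈ range κ, (((2 * c' + 1 : ℝ) - 2 * i) * ((n : ℝ) - 2 * c' - 1 - 2 * i) /
              (((2 * c' : ℝ) - 2 * i) * ((n : ℝ) - 2 * c' - 2 - 2 * i)))) *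
            Real.sqrt (∏ i ∈ range κ, ((2 * i + 1 : ℝ) / ((n : ℝ) - 2 * i)))) := by
  set G : OddSet n → Matrix (Fin r) (Fin (L * m)) ℝ := fun U => Matrix.of fun (i : Fin r) (lc : Fin (L * m)) =>
    g (finProdFinEquiv.symm lc).1 U * A U i (finProdFinEquiv.symm lc).2 with hGdef
  have hGG : ∀ U, G U * (G U)ᵀ = (∑ l, g l U ^ 2) • (A U * (A U)ᵀ) := fun U => sosStack_mul_transpose g A U
  have hG : IsLowDegreeU n (j + k) G := isLowDegreeU_sosStack hg hA
  have h1' : ∀ U, (1 - G U * (G U)ᵀ).PosSemidef := fun U => by rw [hGG]; exact h1 U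
  have h := value_le_of_lowDegree_allModes_sharp hn hdes hD hDk hkc G hG h1' Y hY
  simp_rw [hGG] at h
  exact h

/-- **{0,1} MASKS OF LOW DEGREE ARE FREE** (`f = f²`): for a {0,1}-valued mask `f` of Johnson degree `≤ j` (e.g. `1[U ⊇ J]`, `1[U ∩ J = ∅]`,
`|J| = j`) and a degree-`k` cut factor `A` with `D ≤ j + k ≤ c'`, `f·A Aᵀ ⪯ I`:
`Σ W·f(U)·tr(A_U A_Uᵀ Y_M) ≤ r·(B_v√P_D + 2^{j+k+1}√P_{j+k} + Σ_{κ∈(D/2,(j+k)/2]} R_κ√A_κ)` — no pinned-cell recursion needed.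
[cite: Grigoriev2001, Lemma 1.4 (PDF p. 8)] [cite: Rothvoss2017, §2 (PDF p. 6)] [cite: GriblingDelaatLaurent2019, §5] -/
theorem value_le_of_boolMask {c' T D : ℕ} {Bv : ℝ} {C : Finset ℕ} {w : ℕ → ℝ} (hn : Even n)
    (hdes : IsExactDesign n (2 * c' + 1) T D Bv C w) (hD : D ≤ 2 * c') {r m k j : ℕ} (hDk : D ≤ j + k) (hkc : j + k ≤ c')
    (A : OddSet n → Matrix (Fin r) (Fin m) ℝ) (hA : IsLowDegreeU n k A) (f : OddSet n → ℝ) (hf01 : ∀ U, f U = 0 ∨ f U = 1)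
    (hf : f ∈ Submodule.span ℝ (Set.range fun A' : {A' : Finset (Fin n) // A'.card ≤ j} =>
      fun U : OddSet n => if A'.1 ⊆ U.1 then (1 : ℝ) else 0))
    (h1 : ∀ U, (1 - f U • (A U * (A U)ᵀ)).PosSemidef)
    (Y : PMatch n → Matrix (Fin r) (Fin r) ℝ) (hY : ∀ M, (Y M).PosSemidef ∧ (1 - Y M).PosSemidef) :
    ∑ U, ∑ M, levelWeight n (2 * c' + 1) C w U M * ((f U • (A U * (A U)ᵀ)) * Y M).trace ≤
      (r : ℝ) * (Bv * Real.sqrt (∏ i ∈ range (D / 2 + 1), ((2 * i + 1 : ℝ) / ((n : ℝ) - 2 * i))) +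
        2 ^ (j + k + 1) * Real.sqrt (∏ i ∈ range ((j + k) / 2 + 1), ((2 * i + 1 : ℝ) / ((n : ℝ) - 2 * i))) +
        ∑ κ ∈ Ico (D / 2 + 1) ((j + k) / 2 + 1),
          (∏ i ∈ range κ, (((2 * c' + 1 : ℝ) - 2 * i) * ((n : ℝ) - 2 * c' - 1 - 2 * i) /
              (((2 * c' : ℝ) - 2 * i) * ((n : ℝ) - 2 * c' - 2 - 2 * i)))) *
            Real.sqrt (∏ i ∈ range κ, ((2 * i + 1 : ℝ) / ((n : ℝ) - 2 * i)))) := by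
  -- `f = Σ_{l : Fin 1} f²`
  have hsq : ∀ U, f U = ∑ _l : Fin 1, f U ^ 2 := fun U => by
    rw [Fin.sum_univ_one]
    rcases hf01 U with h | h <;> rw [h] <;> norm_num
  have h := value_le_of_sosMask hn hdes hD hDk hkc A hA (fun _ : Fin 1 => f) (fun _ => hf)
    (fun U => by rw [← hsq U]; exact h1 U) Y hY
  simp_rw [← hsq] at h
  exact h

end Summit.PneNP.PneNP.Theorems.ChebyshevTracialDesignLowDegreeMasks

end
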